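import Literature.Geometry.Riemannian.ABPFieldExpJacobi
import Literature.Geometry.Riemannian.ABPNoConjugate
import Literature.Geometry.Riemannian.ABPFrameSecondVariation
import Literature.Geometry.Riemannian.ParallelTransportCorners
import Literature.Geometry.Riemannian.VolumeSphereTheoremJacobiFrameProofs
import Literature.Geometry.Riemannian.ABPSecondVariation
import Literature.Geometry.Riemannian.ExpMapLiftAlgebra
import Literature.Geometry.Riemannian.RiemVolumeImageLeSelfMap
import Literature.Geometry.Riemannian.ABPVolumeRatioLimit
import Literature.Geometry.Lorentzian.MetricDetComparison
import Literature.Geometry.Riemannian.BakryEmeryHeatFlow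
import HarnessLib

/-!
# Brendle's ABP volume estimate on manifolds with `Ric ≥ 0` — the geometric half of
# Brendle, CPAM 76 (2023), Thm. 1.1, free of the Neumann problem

Topic `Geometry/Riemannian`. S. Brendle's proof of the sharp Sobolev / isoperimetric inequality
on a complete noncompact `n`-manifold `(M, g)` with `Ric ≥ 0` and asymptotic volume ratio `θ`
(CPAM 76 (2023), §2) has two halves: a PDE half (solve `div(f∇u) = n f^{n/(n-1)} − |∇f|` on `D`
with `⟨∇u, η⟩ = 1` on `∂D`; Gilbarg–Trudinger Thm. 6.31) and a geometric half (Lemmas 2.1–2.4,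
Prop. 2.5, Cor. 2.6, the area formula and `r → ∞`). This file proves the GEOMETRIC HALF as one
theorem whose hypotheses are exactly what the PDE half delivers:

**`abp_volume_estimate_of_contact`.** Let `(M, g)` be a connected complete (closed balls
compact) smooth Riemannian `m`-manifold, `m ≥ 1`, with `Ric ≥ 0` and
`Vol(B̄(x₀, r)) / (c_B rᵐ) → θ`. Let `D ⊆ M` be open with compact closure, `u ∈ C^∞(M)`,
`κ ≥ 0` continuous, and assume
* (differential inequality, Brendle's Lemma 2.1) `Δu(x) ≤ m κ(x)` at every `x ∈ D` with
  `|∇u(x)| < 1`;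
* (interior contact, Brendle's Lemma 2.2, first sentence — there from `⟨∇u, η⟩ = 1`) for every
  `r > 0` and every `p` with `d(x, p) < r` for all `x ∈ D̄`, the function
  `x ↦ r u(x) + ½ d(x, p)²` attains its minimum over `D̄` at a point of `D`.
Then `θ · c_B ≤ ∫_{D ∩ {|∇u| < 1}} κᵐ dvol_g`.

(With `κ = f^{1/(n-1)}` and Brendle's normalisation this is `|Bⁿ| θ ≤ ∫_U f^{n/(n-1)}`, the last
display of his §2.) The proof follows Brendle's §2 line by line, assembling the tree's bricks:

* Lemma 2.2 (`hcover`): for such `p`, the minimum point `x̄` and a minimizing geodesic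
  `exp_{x̄}(tV)` from `x̄` to `p` (Hopf–Rinow, `exists_isMinimizingUpTo_expMap_eq`); the first
  variation at the contact point gives `∇u(x̄) = V` (`grad_eq_of_contact`, from
  `ABPSecondVariation`), so `p = Φ_r(x̄)`, `|∇u(x̄)| = d(x̄,p)/r < 1` and `x̄` lies in the contact
  set `A_r`;
* Lemmas 2.3–2.4, Prop. 2.5, Cor. 2.6 (`exists_frame_abs_det_mfderiv_le`): at `x̄ ∈ A_r`, in a
  parallel orthonormal frame along `γ̄(t) = exp_{x̄}(t∇u(x̄))`
  (`exists_parallel_orthonormal_frame_smooth`, globalised by `exists_global_frame_of_local`), the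
  matrix `A(t)` of `dΦ_t(x̄)` (`ABPFieldExpJacobi`: `A' = A₁`, `A₁' = −RA`, `A(0) = 1`,
  `A₁(0) = Hess u`, `tr = Δu`) has no zero of `det` on `[0, r)`
  (`isUnit_det_jacobi_of_secondVariation`, fed by the second variation at the contact point
  `secondVariation_of_contact` through `secondVariation_matrix_of_fields`), hence
  `det A(t) ≤ (1 + tκ(x̄))ᵐ` (`det_le_pow_of_hessian`, `Ric ≥ 0`), and at `t = r` by continuity;
  `dΦ_r(x̄) w_k = ∑ A_{ik}(r) e_i(r)` (`mfderiv_expMap_field_eq_sum_frame`);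
* the area formula (`riemannianMeasure_image_le_lintegral_of_frame`):
  `Vol{p : d(x,p) < r ∀ x ∈ D̄} ≤ Vol(Φ_r(A_r)) ≤ ∫_{A_r} (1 + rκ)ᵐ ≤ ∫_U (1 + rκ)ᵐ`;
* `r → ∞` (`volumeRatio_mul_le_setIntegral_pow_of_measure_le`): `θ c_B ≤ ∫_U κᵐ`.

What is NOT here (the PDE half of Brendle's Thm. 1.1, absent from the tree): existence of `u`
with `div(f∇u) = n f^{n/(n−1)} − |∇f|`, `∂_η u = 1`, of class `C²` up to `∂D`, and the boundary
argument turning `∂_η u = 1` into the interior-contact hypothesis. With those, Thm. 1.1 — and by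
`sharpLogSobolevAVR_four_of_l1Sobolev` the fact `sharpLogSobolevAVR_four` — follow.

Pure proofs; no definitions, no named facts.

## References

* [Brendle2022] S. Brendle, *Sobolev inequalities in manifolds with nonnegative curvature*,
  Comm. Pure Appl. Math. 76 (2023) 2192–2218 (arXiv:2009.13717), §2 (Lemmas 2.1–2.4, Prop. 2.5,
  Cor. 2.6 and the concluding displays). READ (arXiv v2, pp. 4–6).
* [BaloghKristalyTripaldi2024] Z. Balogh, A. Kristály, F. Tripaldi, arXiv:2210.15774, §3.1
  (use of Brendle's inequality).
-/

noncomputable section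

open Bundle Set Filter Function MeasureTheory
open scoped Manifold ContDiff Topology Matrix Matrix.Norms.Operator

namespace Literature.Geometry.Riemannian

open Literature.Geometry.Lorentzian
open Literature.Geometry.Lorentzian.PseudoRiemannianMetric

section FrameBound

variable {E : Type*} [NormedAddCommGroup E] [NormedSpace ℝ E] [FiniteDimensional ℝ E]
  [CompleteSpace E] {H : Type*} [TopologicalSpace H] {I : ModelWithCorners ℝ E H}
  {M : Type*} [TopologicalSpace M] [ChartedSpace H M] [IsManifold I ∞ M] [T2Space M]
  [I.Boundaryless]
  (g : PseudoRiemannianMetric I ∞ E (TangentSpace I : M → Type _)) [g.HasLeviCivita]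
  [CovariantDerivative.ContMDiffCovariantDerivative g.leviCivita 1]
  [CovariantDerivative.ContMDiffCovariantDerivative g.leviCivita ∞]

/-- Matrices built with `Matrix.of` from smooth entries are smooth (for the scoped operator norm
on matrices: `Matrix.of` is a continuous linear map from `ι → κ → ℝ`). [folklore] -/
theorem contDiff_matrix_of {ι κ : Type*} [Fintype ι] [Fintype κ] [DecidableEq ι] [DecidableEq κ]
    {F : ℝ → ι → κ → ℝ} (hF : ∀ i k, ContDiff ℝ ∞ fun t ↦ F t i k) :
    ContDiff ℝ ∞ fun t ↦ Matrix.of (F t) := by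
  set L : (ι → κ → ℝ) →L[ℝ] Matrix ι κ ℝ := LinearMap.toContinuousLinearMap
    (Matrix.ofLinearEquiv ℝ : (ι → κ → ℝ) ≃ₗ[ℝ] Matrix ι κ ℝ).toLinearMap with hL
  have hF' : ContDiff ℝ ∞ F := contDiff_pi.2 fun i ↦ contDiff_pi.2 fun k ↦ hF i k
  exact L.contDiff.comp hF'

set_option maxHeartbeats 1600000 in
/-- **The Jacobian bound at a contact point** (Brendle 2023, Lemmas 2.3–2.4, Prop. 2.5,
Cor. 2.6: `|det DΦ_r(x̄)| ≤ (1 + r f(x̄)^{1/(n−1)})ⁿ` for `x̄ ∈ A_r`). Let `g` be smooth Riemannian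
with complete Levi-Civita connection and `Ric ≥ 0`, `u ∈ C^∞`, `x₀ ∈ M`, `r > 0`, `κ₀ ≥ 0`
with `Δu(x₀) ≤ (card ι) κ₀`, `w` a `g`-orthonormal basis of `T_{x₀}M`, and suppose the second
variation inequality holds at `x₀` along `γ̄(t) = exp_{x₀}(t∇u(x₀))` for all smooth fields
vanishing at `r` (hypothesis `hSV0`, supplied by `secondVariation_of_contact`). Then there are a
`g`-orthonormal basis `ε` of `T_{Φ_r x₀}M` and a matrix `A` with `dΦ_r(x₀) w_k = ∑ᵢ A_{ik} εᵢ` and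
`|det A| ≤ (1 + rκ₀)^{card ι}`, where `Φ_r(z) = exp_z(r∇u(z))`: parallel orthonormal frame
(`exists_parallel_orthonormal_frame_smooth`, `exists_global_frame_of_local`), frame matrices of
`dΦ_t` (`ABPFieldExpJacobi`), no conjugate points (`isUnit_det_jacobi_of_secondVariation` via
`secondVariation_matrix_of_fields`), comparison (`det_le_pow_of_hessian`), limit `t → r⁻`.
[cite: Brendle2022, Prop. 2.5 and Cor. 2.6] -/
theorem exists_frame_abs_det_mfderiv_le (hg : g.IsRiemannian)
    (hc : IsGeodesicallyComplete g.leviCivita)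
    (hRic : ∀ (x : M) (v : TangentSpace I x), 0 ≤ g.leviCivita.ricci x v v)
    {u : M → ℝ} (hu : CMDiff ∞ u) (x₀ : M) {r : ℝ} (hr : 0 < r) {κ₀ : ℝ} (hκ₀ : 0 ≤ κ₀)
    {ι : Type*} [Fintype ι] [DecidableEq ι] [Nonempty ι]
    (hcard : Fintype.card ι = Module.finrank ℝ E)
    (hΔ : g.dalembertian u x₀ ≤ Fintype.card ι * κ₀)
    (w : ι → TangentSpace I x₀) (hw : ∀ i j, g.val x₀ (w i) (w j) = if i = j then 1 else 0)
    (hSV0 : ∀ X : Π t : ℝ, TangentSpace I (expMap g.leviCivita x₀ (t • grad g u x₀)),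
      ContMDiff 𝓘(ℝ, ℝ) I.tangent ∞ (fun t ↦ (TotalSpace.mk' E
        (expMap g.leviCivita x₀ (t • grad g u x₀)) (X t) : TangentBundle I M)) →
      X r = 0 →
      0 ≤ g.hessian u (expMap g.leviCivita x₀ ((0 : ℝ) • grad g u x₀)) (X 0) (X 0) +
        ∫ t in (0 : ℝ)..r,
        (g.val (expMap g.leviCivita x₀ (t • grad g u x₀))
            (g.leviCivita.curvature (expMap g.leviCivita x₀ (t • grad g u x₀)) (X t)
              (velocity I (fun t : ℝ ↦ expMap g.leviCivita x₀ (t • grad g u x₀)) t) (X t))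
            (velocity I (fun t : ℝ ↦ expMap g.leviCivita x₀ (t • grad g u x₀)) t) +
          g.val (expMap g.leviCivita x₀ (t • grad g u x₀))
            (covariantDerivAlong g.leviCivita (fun t : ℝ ↦ expMap g.leviCivita x₀ (t • grad g u x₀))
              X t)
            (covariantDerivAlong g.leviCivita (fun t : ℝ ↦ expMap g.leviCivita x₀ (t • grad g u x₀))
              X t))) :
    ∃ (ε : ι → TangentSpace I (expMap g.leviCivita x₀ (r • grad g u x₀))) (A : Matrix ι ι ℝ),
      (∀ i j, g.val (expMap g.leviCivita x₀ (r • grad g u x₀)) (ε i) (ε j) =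
        if i = j then 1 else 0) ∧
      (∀ k, mfderiv I I (fun z ↦ expMap g.leviCivita z (r • grad g u z)) x₀ (w k) =
        ∑ i, A i k • ε i) ∧
      |A.det| ≤ (1 + r * κ₀) ^ Fintype.card ι := by
  haveI : Fact ((1 : ℕ∞ω) ≤ ∞) := ⟨by exact_mod_cast le_top⟩
  have hLC : g.IsLeviCivita g.leviCivita := isLeviCivita_leviCivita_holds (g := g)
  have hreg1 : g.leviCivita.IsLocallyContMDiff 1 :=
    g.isLocallyContMDiff_leviCivita_holds 1
      (show ((1 : ℕ∞) : ℕ∞ω) + 1 ≤ ∞ from WithTop.coe_le_coe.2 le_top)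
  have hregI : g.leviCivita.IsLocallyContMDiff (⊤ : ℕ∞) :=
    g.isLocallyContMDiff_leviCivita_holds ⊤ (le_of_eq rfl)
  have h2n : (2 : ℕ∞ω) ≤ ∞ := WithTop.coe_le_coe.2 le_top
  -- the gradient field and the geodesic `γ(t) = exp_{x₀}(t ∇u(x₀))`
  set V : Π x : M, TangentSpace I x := grad g u with hV_def
  have hV : ContMDiff I I.tangent ∞ (fun z ↦ (TotalSpace.mk' E z (V z) : TangentBundle I M)) :=
    contMDiff_grad g hu
  set γ : ℝ → M := fun t ↦ expMap g.leviCivita x₀ (t • V x₀) with hγ_def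
  have hγs : ContMDiff 𝓘(ℝ, ℝ) I ∞ γ :=
    (contMDiff_expMap_of_isGeodesicallyComplete (cov := g.leviCivita) (k := (⊤ : ℕ∞)) le_top hc
      x₀).comp ((contDiff_id.smul contDiff_const).contMDiff)
  have hgeo : IsGeodesic g.leviCivita γ :=
    isGeodesic_expMap_smul_of_isGeodesicallyComplete hc x₀ (V x₀)
  have hγ0 : γ 0 = x₀ := by
    show expMap g.leviCivita x₀ ((0 : ℝ) • V x₀) = x₀
    rw [zero_smul, expMap_zero]
  -- an orthonormal parallel frame through `w`, globally smooth, on `(-1, r+1)`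
  have hw' : ∀ i j, g.val (γ 0) (w i) (w j) = if i = j then 1 else 0 := by
    have aux : ∀ q : M, q = x₀ → ∀ i j, g.val q (w i) (w j) = if i = j then 1 else 0 := by
      intro q hq; subst hq; exact hw
    exact aux _ hγ0
  have h0ab : (0 : ℝ) ∈ Ioo (-2 : ℝ) (r + 2) := ⟨by norm_num, by linarith⟩
  obtain ⟨e, he0, hepar, hes, heon⟩ := exists_parallel_orthonormal_frame_smooth g hg hLC.2 hregI
    hγs h0ab (fun i ↦ (w i : TangentSpace I (γ 0))) hw'
  obtain ⟨f, hfs, hfpar, hfon, hfeq⟩ := exists_global_frame_of_local g hγs (a := -2) (a' := -1)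
    (b' := r + 1) (b := r + 2) (by norm_num) (by linarith) hepar hes heon
  have hf0 : ∀ i, f i 0 = w i := fun i ↦
    (hfeq i 0 ⟨by norm_num, by linarith⟩).trans (he0 i)
  have h0s : (0 : ℝ) ∈ Ioo (-1 : ℝ) (r + 1) := ⟨by norm_num, by linarith⟩
  have hrs : r ∈ Ioo (-1 : ℝ) (r + 1) := ⟨by linarith, by linarith⟩
  have hIcc : ∀ t ∈ Ico (0 : ℝ) r, t ∈ Ioo (-1 : ℝ) (r + 1) := fun t ht ↦
    ⟨by linarith [ht.1], by linarith [ht.2]⟩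
  -- the matrices
  set A : ℝ → Matrix ι ι ℝ := fun t ↦ Matrix.of fun i k ↦ g.val (γ t)
    (mfderiv I I (fun z ↦ expMap g.leviCivita z (t • V z)) x₀ (w k)) (f i t) with hA_def
  set A₁ : ℝ → Matrix ι ι ℝ := fun t ↦ Matrix.of fun i k ↦ g.val (γ t)
    (covariantDerivAlong g.leviCivita γ
      (fun t : ℝ ↦ mfderiv I I (fun z ↦ expMap g.leviCivita z (t • V z)) x₀ (w k)) t) (f i t)
    with hA₁_def
  set R : ℝ → Matrix ι ι ℝ := fun t ↦ Matrix.of fun i j ↦ g.val (γ t)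
    (g.leviCivita.curvature (γ t) (f j t) (velocity I γ t) (velocity I γ t)) (f i t) with hR_def
  set Hg : Matrix ι ι ℝ := Matrix.of fun i k ↦ g.val x₀ (g.leviCivita V x₀ (w k)) (w i) with hHg
  -- `A' = A₁`, `A₁' = -R A`
  have hAA' : ∀ t ∈ Ioo (-1 : ℝ) (r + 1), HasDerivAt A (A₁ t) t ∧ HasDerivAt A₁ (-(R t * A t)) t :=
    fun t ht ↦ hasDerivAt_frameMatrix_mfderiv_expMap_field g hreg1 hc hV x₀ (s := Ioo (-1) (r + 1))
      hfpar hfon hcard w ht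
  -- initial data
  obtain ⟨hA0, hA₁0⟩ : A 0 = 1 ∧ A₁ 0 = Hg :=
    frameMatrix_mfderiv_expMap_field_zero g hreg1 hc hV x₀ hfon h0s w hf0
  obtain ⟨hHg_hess, hHg_symm, hHg_tr⟩ := frameMatrix_leviCivita_grad g
    ((hu x₀).of_le h2n) w hw hcard
  -- the second variation in matrix form, with `H = Hg`
  have hHess_eq : (Matrix.of fun i k ↦ g.hessian u (γ 0) (f k 0) (f i 0)) = Hg := by
    have aux : ∀ q : M, q = x₀ → ∀ (X : ι → E), (∀ i, X i = w i) →
        (Matrix.of fun i k ↦ g.hessian u q (X k) (X i)) =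
          Matrix.of fun i k ↦ g.hessian u x₀ (w k) (w i) := by
      intro q hq X hX
      subst hq
      ext i k
      simp only [Matrix.of_apply, hX]
    rw [aux _ hγ0 (fun i ↦ f i 0) hf0, ← hHg_hess]
  have hSV : ∀ Z : ℝ → Matrix ι ι ℝ, ContDiff ℝ ∞ Z → Z r = 0 →
      0 ≤ ((Z 0)ᵀ * (Hg * Z 0)).trace + ∫ t in (0 : ℝ)..r,
        (((deriv Z t)ᵀ * deriv Z t).trace - ((Z t)ᵀ * (R t * Z t)).trace) := by
    intro Z hZ hZr
    have h := secondVariation_matrix_of_fields g le_rfl hc hγs hr (a := -1) (b := r + 1)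
      (by norm_num) (by linarith) hfpar (fun i t _ ↦ hfs i t) hfon hSV0 Z hZ hZr
    rwa [hHess_eq] at h
  -- smoothness of `A`, symmetry and continuity of `R`, `tr R ≥ 0`
  have hJs : ∀ k, ContMDiff 𝓘(ℝ, ℝ) I.tangent ∞ (fun t : ℝ ↦ (TotalSpace.mk' E (γ t)
      (mfderiv I I (fun z ↦ expMap g.leviCivita z (t • V z)) x₀ (w k)) : TangentBundle I M)) :=
    fun k ↦ contMDiff_lift_mfderiv_expMap_field hc hV x₀ (w k)
  have hAs : ContDiff ℝ ∞ A := by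
    refine contDiff_matrix_of fun i k ↦ ?_
    exact contMDiff_iff_contDiff.1 fun t ↦ contMDiffAt_val_apply_along g le_rfl (hJs k t) (hfs i t)
  have hRsymm : ∀ t, (R t).IsSymm := fun t ↦
    isSymm_frameMatrix_curvature g hLC.2 hreg1 hLC.1 h2n f t
  have hRc : ContinuousOn R (Ioo (-1 : ℝ) (r + 1)) := fun t ht ↦
    (continuousAt_frameMatrix_curvature g g.leviCivita hreg1 hregI
      (γ := γ) (s := Ioo (-1 : ℝ) (r + 1))
      ⟨fun t _ ↦ hgeo.1 t (mem_univ t), fun t _ ↦ hgeo.2 t (mem_univ t)⟩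
      hfpar ht).continuousWithinAt
  have hRic' : ∀ t ∈ Ico (0 : ℝ) r, 0 ≤ (R t).trace := fun t ht ↦ by
    rw [trace_frameMatrix_curvature g g.leviCivita (hfon t (hIcc t ht)) hcard]
    exact hRic _ _
  -- no conjugate points (Lemma 2.4) and the Jacobian comparison (Prop. 2.5 / Cor. 2.6)
  have hunit : ∀ t ∈ Ico (0 : ℝ) r, IsUnit (A t).det :=
    isUnit_det_jacobi_of_secondVariation h0s (by linarith) hr hAs (fun t ht ↦ (hAA' t ht).1)
      (fun t ht ↦ (hAA' t ht).2) (fun t _ ↦ hRsymm t) hRc hA0 hA₁0 hHg_symm hSV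
  have hS0 : (A₁ 0).IsSymm := by rw [hA₁0]; exact hHg_symm
  have htr : (A₁ 0).trace ≤ Fintype.card ι * κ₀ := by rw [hA₁0, hHg_tr]; exact hΔ
  have hdet : ∀ t ∈ Ico (0 : ℝ) r, (A t).det ≤ (1 + t * κ₀) ^ Fintype.card ι :=
    det_le_pow_of_hessian h0s (by linarith) (fun t ht ↦ (hAA' t ht).1)
      (fun t ht ↦ (hAA' t ht).2) (fun t _ ↦ hRsymm t) hRic' hA0 hS0 hκ₀ htr hunit
  have hpos : ∀ t ∈ Ico (0 : ℝ) r, 0 < (A t).det :=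
    det_jacobi_pos_of_isUnit hAs.continuous.continuousOn hA0 hunit
  -- pass to `t = r`
  have hAc : Continuous fun t ↦ (A t).det := continuous_id.matrix_det.comp hAs.continuous
  have h1 : Tendsto (fun t ↦ (A t).det) (𝓝[<] r) (𝓝 (A r).det) :=
    hAc.continuousAt.tendsto.mono_left nhdsWithin_le_nhds
  have h2 : Tendsto (fun t : ℝ ↦ (1 + t * κ₀) ^ Fintype.card ι) (𝓝[<] r)
      (𝓝 ((1 + r * κ₀) ^ Fintype.card ι)) :=
    (((continuous_const.add (continuous_id.mul continuous_const)).pow _).continuousAt.tendsto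
      ).mono_left nhdsWithin_le_nhds
  have hev : ∀ᶠ t in 𝓝[<] r, t ∈ Ico (0 : ℝ) r := by
    filter_upwards [Ioo_mem_nhdsLT hr] with t ht using ⟨ht.1.le, ht.2⟩
  have hle : (A r).det ≤ (1 + r * κ₀) ^ Fintype.card ι :=
    le_of_tendsto_of_tendsto h1 h2 (hev.mono fun t ht ↦ hdet t ht)
  have hge : 0 ≤ (A r).det :=
    ge_of_tendsto h1 (hev.mono fun t ht ↦ (hpos t ht).le)
  -- the frame expansion at `t = r`
  have hexp := (mfderiv_expMap_field_eq_sum_frame g x₀ hfon hcard w hrs).1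
  refine ⟨fun i ↦ f i r, A r, hfon r hrs, fun k ↦ hexp k, ?_⟩
  rw [abs_of_nonneg hge]
  exact hle


/-- **`Φ_t : z ↦ exp_z(t V(z))` is smooth** for a smooth field `V` and a complete connection
(`contMDiffOn_expMap_totalSpace` composed with the smooth section `z ↦ (z, tV(z))`). Brendle 2023,
§2 ("the map `Φ_r` is of class `C^{1,γ}`"; here `u ∈ C^∞`). [cite: Brendle2022, §2] -/
theorem contMDiff_expMap_field_smul (hc : IsGeodesicallyComplete g.leviCivita)
    {V : Π x : M, TangentSpace I x}
    (hV : ContMDiff I I.tangent ∞ (fun z ↦ (TotalSpace.mk' E z (V z) : TangentBundle I M)))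
    (t : ℝ) : ContMDiff I I ∞ (fun z ↦ expMap g.leviCivita z (t • V z)) := by
  have hF : ContMDiff I I.tangent ∞
      (fun z ↦ (TotalSpace.mk' E z (t • V z) : TangentBundle I M)) :=
    contMDiff_liftAlong_smul (c := fun z : M ↦ z) hV contMDiff_const
  have hexp := contMDiffOn_expMap_totalSpace (cov := g.leviCivita) (k := (⊤ : ℕ∞)) le_top
  have hmem : ∀ z : M, (TotalSpace.mk' E z (t • V z) : TangentBundle I M) ∈
      {p : TangentBundle I M | (1 : ℝ) ∈ maximalGeodesicDomain g.leviCivita p.proj p.2} :=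
      fun z ↦ by
    show (1 : ℝ) ∈ maximalGeodesicDomain g.leviCivita z (t • V z)
    rw [(maximalGeodesic_of_isGeodesicallyComplete hc _ _).1]
    exact mem_univ _
  exact hexp.comp_contMDiff hF hmem

set_option maxHeartbeats 800000 in
/-- **First and second variation at a contact point, from the contact inequality** (Brendle
2023, Lemmas 2.2–2.3): if `r u(x₀) + ½(r|V|)² ≤ r u(y) + ½ d(y, exp_{x₀}(rV))²` for all `y` near
`x₀`, then for every smooth `X` along `t ↦ exp_{x₀}(tV)` with `X(r) = 0`,
`du(X(0)) = g(X(0), γ'(0))` and `0 ≤ Hess u(X0,X0) + ∫₀ʳ [g(R(X,γ')X,γ') + |D_tX|²]`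
(`eventually_energy_minimal_of_contact` for `X` and `−X`, then
`mvfderiv_eq_and_secondVariation_nonneg_of_minimal`). [cite: Brendle2022, Lemmas 2.2–2.3] -/
theorem secondVariation_of_contact (hg : g.IsRiemannian)
    (hc : IsGeodesicallyComplete g.leviCivita) {u : M → ℝ} (hu : CMDiff ∞ u) (x₀ : M)
    (V : TangentSpace I x₀) {r : ℝ} (hr : 0 < r)
    (hcontact : ∀ᶠ y in 𝓝 x₀, r * u x₀ + 1 / 2 * (r * Real.sqrt (g.val x₀ V V)) ^ 2 ≤
      r * u y + 1 / 2 * (g.edist hg y (expMap g.leviCivita x₀ (r • V))).toReal ^ 2)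
    (X : Π t : ℝ, TangentSpace I (expMap g.leviCivita x₀ (t • V)))
    (hX : ContMDiff 𝓘(ℝ, ℝ) I.tangent ∞ (fun t ↦ (TotalSpace.mk' E
      (expMap g.leviCivita x₀ (t • V)) (X t) : TangentBundle I M)))
    (hXr : X r = 0) :
    mvfderiv I u (expMap g.leviCivita x₀ ((0 : ℝ) • V)) (X 0) =
        g.val (expMap g.leviCivita x₀ ((0 : ℝ) • V)) (X 0)
          (velocity I (fun t : ℝ ↦ expMap g.leviCivita x₀ (t • V)) 0) ∧
      0 ≤ g.hessian u (expMap g.leviCivita x₀ ((0 : ℝ) • V)) (X 0) (X 0) +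
        ∫ t in (0 : ℝ)..r,
        (g.val (expMap g.leviCivita x₀ (t • V))
            (g.leviCivita.curvature (expMap g.leviCivita x₀ (t • V)) (X t)
              (velocity I (fun t : ℝ ↦ expMap g.leviCivita x₀ (t • V)) t) (X t))
            (velocity I (fun t : ℝ ↦ expMap g.leviCivita x₀ (t • V)) t) +
          g.val (expMap g.leviCivita x₀ (t • V))
            (covariantDerivAlong g.leviCivita (fun t : ℝ ↦ expMap g.leviCivita x₀ (t • V)) X t)
            (covariantDerivAlong g.leviCivita (fun t : ℝ ↦ expMap g.leviCivita x₀ (t • V)) X t)) :=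
  by
  haveI : Fact ((1 : ℕ∞ω) ≤ ∞) := ⟨by exact_mod_cast le_top⟩
  have hγs : ContMDiff 𝓘(ℝ, ℝ) I ∞ (fun t : ℝ ↦ expMap g.leviCivita x₀ (t • V)) :=
    (contMDiff_expMap_of_isGeodesicallyComplete (cov := g.leviCivita) (k := (⊤ : ℕ∞)) le_top hc
      x₀).comp ((contDiff_id.smul contDiff_const).contMDiff)
  have hgeo : IsGeodesic g.leviCivita (fun t : ℝ ↦ expMap g.leviCivita x₀ (t • V)) :=
    isGeodesic_expMap_smul_of_isGeodesicallyComplete hc x₀ V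
  have hu2 : ∀ᶠ y in 𝓝 (expMap g.leviCivita x₀ ((0 : ℝ) • V)), CMDiffAt 2 u y :=
    Eventually.of_forall fun y ↦ (hu y).of_le (WithTop.coe_le_coe.2 le_top)
  -- minimality for `X` and for `-X`
  have hY : ContMDiff 𝓘(ℝ, ℝ) I.tangent ∞ (fun t ↦ (TotalSpace.mk' E
      (expMap g.leviCivita x₀ (t • V)) ((-1 : ℝ) • X t) : TangentBundle I M)) := fun t ↦
    HarmonicMap.contMDiffAt_lift_smul (hX t) contMDiffAt_const
  have hYr : (fun t ↦ (-1 : ℝ) • X t) r = 0 := by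
    show (-1 : ℝ) • X r = 0
    rw [hXr, smul_zero]
  have hmin := eventually_energy_minimal_of_contact g le_rfl hg hc x₀ V hr hX hXr hcontact
  have hmin' := eventually_energy_minimal_of_contact g le_rfl hg hc x₀ V hr
    (X := fun t ↦ (-1 : ℝ) • X t) hY hYr hcontact
  exact mvfderiv_eq_and_secondVariation_nonneg_of_minimal g le_rfl hc hgeo hγs hX hr hXr hu2
    hmin hmin'

set_option maxHeartbeats 800000 in
/-- **`∇u(x̄) = γ̄'(0)` at a contact point** (Brendle 2023, Lemma 2.2: "the formula for the first
variation of energy implies `∇u(x̄) = γ̄'(0)`"): under the local contact inequality at `x₀` for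
the geodesic `t ↦ exp_{x₀}(tV)`, `grad u(x₀) = V` — apply the first variation
(`secondVariation_of_contact`) to the fields `(1 − t/r) eᵢ(t)` of a parallel frame through an
orthonormal basis `w`, so `du(wᵢ) = g(wᵢ, V)` for all `i`. [cite: Brendle2022, Lemma 2.2] -/
theorem grad_eq_of_contact (hg : g.IsRiemannian)
    (hc : IsGeodesicallyComplete g.leviCivita) {u : M → ℝ} (hu : CMDiff ∞ u) (x₀ : M)
    (V : TangentSpace I x₀) {r : ℝ} (hr : 0 < r) {ι : Type*} [Fintype ι] [DecidableEq ι]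
    (hcard : Fintype.card ι = Module.finrank ℝ E)
    (w : ι → TangentSpace I x₀) (hw : ∀ i j, g.val x₀ (w i) (w j) = if i = j then 1 else 0)
    (hcontact : ∀ᶠ y in 𝓝 x₀, r * u x₀ + 1 / 2 * (r * Real.sqrt (g.val x₀ V V)) ^ 2 ≤
      r * u y + 1 / 2 * (g.edist hg y (expMap g.leviCivita x₀ (r • V))).toReal ^ 2) :
    grad g u x₀ = V := by
  haveI : Fact ((1 : ℕ∞ω) ≤ ∞) := ⟨by exact_mod_cast le_top⟩
  have hLC : g.IsLeviCivita g.leviCivita := isLeviCivita_leviCivita_holds (g := g)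
  have hregI : g.leviCivita.IsLocallyContMDiff (⊤ : ℕ∞) :=
    g.isLocallyContMDiff_leviCivita_holds ⊤ (le_of_eq rfl)
  set γ : ℝ → M := fun t ↦ expMap g.leviCivita x₀ (t • V) with hγ_def
  have hγs : ContMDiff 𝓘(ℝ, ℝ) I ∞ γ :=
    (contMDiff_expMap_of_isGeodesicallyComplete (cov := g.leviCivita) (k := (⊤ : ℕ∞)) le_top hc
      x₀).comp ((contDiff_id.smul contDiff_const).contMDiff)
  have hγ0 : γ 0 = x₀ := by
    show expMap g.leviCivita x₀ ((0 : ℝ) • V) = x₀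
    rw [zero_smul, expMap_zero]
  have hv0 : (velocity I γ 0 : E) = (V : E) := velocity_expMap_smul_zero x₀ V
  -- frames through `w`
  have hw' : ∀ i j, g.val (γ 0) (w i) (w j) = if i = j then 1 else 0 := by
    have aux : ∀ q : M, q = x₀ → ∀ i j, g.val q (w i) (w j) = if i = j then 1 else 0 := by
      intro q hq; subst hq; exact hw
    exact aux _ hγ0
  have h0ab : (0 : ℝ) ∈ Ioo (-2 : ℝ) (r + 2) := ⟨by norm_num, by linarith⟩
  obtain ⟨e, he0, hepar, hes, heon⟩ := exists_parallel_orthonormal_frame_smooth g hg hLC.2 hregI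
    hγs h0ab (fun i ↦ (w i : TangentSpace I (γ 0))) hw'
  obtain ⟨f, hfs, -, -, hfeq⟩ := exists_global_frame_of_local g hγs (a := -2) (a' := -1)
    (b' := r + 1) (b := r + 2) (by norm_num) (by linarith) hepar hes heon
  have hf0 : ∀ i, f i 0 = w i := fun i ↦
    (hfeq i 0 ⟨by norm_num, by linarith⟩).trans (he0 i)
  -- the fields `X_i = (1 - t/r) f_i`
  have hφ : ContMDiff 𝓘(ℝ, ℝ) 𝓘(ℝ, ℝ) ∞ (fun t : ℝ ↦ 1 - t / r) :=
    (contDiff_const.sub (contDiff_id.div_const r)).contMDiff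
  have hdu : ∀ i, mvfderiv I u x₀ (w i) = g.val x₀ (w i) V := by
    intro i
    have hXs : ContMDiff 𝓘(ℝ, ℝ) I.tangent ∞ (fun t ↦ (TotalSpace.mk' E (γ t)
        ((1 - t / r) • f i t) : TangentBundle I M)) := fun t ↦
      HarmonicMap.contMDiffAt_lift_smul (hfs i t) (hφ t)
    have hXr : (fun t ↦ (1 - t / r) • f i t) r = 0 := by
      show (1 - r / r) • f i r = 0
      rw [div_self hr.ne', sub_self, zero_smul]
    have h := (secondVariation_of_contact g hg hc hu x₀ V hr hcontact
      (fun t ↦ (1 - t / r) • f i t) hXs hXr).1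
    have hX0 : ((fun t ↦ (1 - t / r) • f i t) 0 : E) = (w i : E) := by
      show (1 - 0 / r) • f i 0 = w i
      rw [zero_div, sub_zero, one_smul, hf0]
    have aux : ∀ q : M, q = x₀ → ∀ (a b : E), a = w i → b = V →
        mvfderiv I u q a = g.val q a b → mvfderiv I u x₀ (w i) = g.val x₀ (w i) V := by
      intro q hq a b ha hb h'
      subst hq; subst ha; subst hb; exact h'
    exact aux _ hγ0 _ _ hX0 hv0 h
  -- hence `grad u(x₀) = V`
  have hcoef : ∀ i, g.val x₀ (grad g u x₀ - V) (w i) = 0 := fun i ↦ by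
    rw [map_sub, sub_apply, val_grad, hdu i, g.symm x₀ (w i) V, sub_self]
  have hexp := eq_sum_bilin_smul_of_orthonormal (V := E) (g.val x₀) hw hcard (grad g u x₀ - V)
  have hsum : (∑ i, g.val x₀ (grad g u x₀ - V) (w i) • w i : TangentSpace I x₀) = 0 :=
    Finset.sum_eq_zero fun i _ ↦ by rw [hcoef i, zero_smul]
  exact sub_eq_zero.1 (hexp.trans hsum)

end FrameBound


/-! ### The PDE-free ABP volume estimate -/

section Main

variable {m : ℕ} {M : Type*} [TopologicalSpace M] [ChartedSpace (EuclideanSpace ℝ (Fin m)) M]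
  [IsManifold (𝓡 m) ∞ M] [T2Space M] [SecondCountableTopology M] [ConnectedSpace M]
  [T3Space M] [MeasurableSpace M] [BorelSpace M]
  (g : PseudoRiemannianMetric (𝓡 m) ∞ (EuclideanSpace ℝ (Fin m)) (TangentSpace (𝓡 m) : M → Type _))
  [g.HasLeviCivita]

omit [T2Space M] [SecondCountableTopology M] [ConnectedSpace M] [T3Space M] [MeasurableSpace M]
  [BorelSpace M] [g.HasLeviCivita] in
/-- A `g_x`-orthonormal basis of `T_xM` indexed by `Fin m` (`exists_orthonormal_basis`,
reindexed along `dim T_xM = m`). [folklore] -/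
theorem exists_orthonormal_basis_fin (hg : g.IsRiemannian) (x : M) :
    ∃ w : Fin m → TangentSpace (𝓡 m) x, ∀ i j, g.val x (w i) (w j) = if i = j then 1 else 0 := by
  obtain ⟨b, hb⟩ := g.exists_orthonormal_basis x hg
  have hfin : Module.finrank ℝ (TangentSpace (𝓡 m) x) = m := finrank_euclideanSpace_fin
  refine ⟨fun i ↦ b ((finCongr hfin).symm i), fun i j ↦ ?_⟩
  rw [hb]
  simp only [EmbeddingLike.apply_eq_iff_eq]

set_option maxHeartbeats 3200000 in
/-- **Brendle's ABP volume estimate, geometric half** (Brendle, CPAM 76 (2023), §2, proof of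
Thm. 1.1: Lemmas 2.2–2.4, Prop. 2.5, Cor. 2.6 and the two concluding displays
"`|{p : d(x,p) < r ∀ x ∈ D}| ≤ ∫_U (1 + r f^{1/(n−1)})ⁿ`", "divide by `rⁿ`, `r → ∞`:
`|Bⁿ| θ ≤ ∫_U f^{n/(n−1)}`"). For a connected complete smooth Riemannian `m`-manifold (`m ≥ 1`,
closed balls compact) with `Ric ≥ 0` and `Vol(B̄(x₀,r))/(c_B rᵐ) → θ`, an open `D` with compact
closure, `u ∈ C^∞(M)`, a continuous `κ ≥ 0` with `Δu ≤ mκ` on `D ∩ {|∇u| < 1}`, and the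
interior-contact property (for every `r > 0` and every `p` with `d(x,p) < r` on `D̄`, the minimum
of `x ↦ r u(x) + ½ d(x,p)²` over `D̄` is attained in `D`) — which is what Brendle's Neumann
condition `⟨∇u, η⟩ = 1` provides — one has `θ c_B ≤ ∫_{D ∩ {|∇u|<1}} κᵐ dvol_g`. See the module
docstring for the proof. [cite: Brendle2022, Thm. 1.1 (proof, §2)] -/
theorem abp_volume_estimate_of_contact (hm : 0 < m) (hg : g.IsRiemannian)
    (hcpt : ∀ (x : M) (r : NNReal), IsCompact {y : M | g.edist hg x y ≤ r})
    (hRic : ∀ (x : M) (v : TangentSpace (𝓡 m) x), 0 ≤ g.ricci x v v)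
    {θ cB : ℝ} (hcB : 0 < cB) (x₀ : M)
    (havr : Tendsto (fun r : ℝ ↦ ((riemannianMeasure (g.toContMDiffRiemannianMetric hg))
      {y : M | g.edist hg x₀ y ≤ ENNReal.ofReal r}).toReal / (cB * r ^ m)) atTop (𝓝 θ))
    {D : Set M} (hD : IsOpen D) (hDc : IsCompact (closure D))
    {u : M → ℝ} (hu : ContMDiff (𝓡 m) 𝓘(ℝ, ℝ) ∞ u) {κ : M → ℝ} (hκc : Continuous κ)
    (hκ0 : ∀ x, 0 ≤ κ x)
    (hpde : ∀ x ∈ D, g.gradSq u x < 1 → g.dalembertian u x ≤ m * κ x)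
    (hcontact : ∀ r : ℝ, 0 < r → ∀ p : M, (∀ x ∈ closure D, g.edist hg x p < ENNReal.ofReal r) →
      ∃ x₁ ∈ D, ∀ x ∈ closure D, r * u x₁ + 1 / 2 * (g.edist hg x₁ p).toReal ^ 2 ≤
        r * u x + 1 / 2 * (g.edist hg x p).toReal ^ 2) :
    θ * cB ≤ ∫ x in {x | x ∈ D ∧ g.gradSq u x < 1}, κ x ^ m
      ∂(riemannianMeasure (g.toContMDiffRiemannianMetric hg)) := by
  classical
  -- instances and completeness
  haveI : Nonempty (Fin m) := ⟨⟨0, hm⟩⟩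
  have hk1 : ((1 : ℕ∞) : ℕ∞ω) + 1 ≤ ((⊤ : ℕ∞) : ℕ∞ω) := by
    rw [show ((1 : ℕ∞) : ℕ∞ω) + 1 = 2 by norm_num]
    exact WithTop.coe_le_coe.2 le_top
  haveI : CovariantDerivative.ContMDiffCovariantDerivative g.leviCivita 1 :=
    ⟨g.isLocallyContMDiff_leviCivita_holds 1 hk1 univ isOpen_univ⟩
  haveI : CovariantDerivative.ContMDiffCovariantDerivative g.leviCivita ((⊤ : ℕ∞) : ℕ∞ω) :=
    ⟨g.isLocallyContMDiff_leviCivita_holds ⊤ (le_of_eq rfl) univ isOpen_univ⟩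
  haveI : Fact ((1 : ℕ∞ω) ≤ ((⊤ : ℕ∞) : ℕ∞ω)) := ⟨by exact_mod_cast le_top⟩
  have hc : IsGeodesicallyComplete g.leviCivita :=
    (isGeodesicallyComplete_iff_isCompact_setOf_edist_le g le_rfl hg).2 hcpt
  have hRic' : ∀ (x : M) (v : TangentSpace (𝓡 m) x), 0 ≤ g.leviCivita.ricci x v v := hRic
  have hcard : Fintype.card (Fin m) = Module.finrank ℝ (EuclideanSpace ℝ (Fin m)) := by
    rw [Fintype.card_fin, finrank_euclideanSpace_fin]
  set h := g.toContMDiffRiemannianMetric hg with hh_def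
  set μ : Measure M := riemannianMeasure h with hμ
  haveI : IsFiniteMeasureOnCompacts μ :=
    ⟨fun K hK ↦ riemannianVolume_lt_top_of_isCompact_holds _ le_rfl hK⟩
  have hfin : ∀ a b : M, g.edist hg a b ≠ ⊤ := fun a b ↦ edist_ne_top hg a b
  -- continuity of the data
  have huc : Continuous u := hu.continuous
  have hgc : Continuous (g.gradSq u) := (contMDiff_gradSq g hu).continuous
  have hdc : ∀ y : M, Continuous fun x : M ↦ (g.edist hg y x).toReal := fun y ↦ by
    have h1 : Continuous fun x ↦ g.edist hg y x :=
      (PseudoRiemannianMetric.continuous_edist hg).comp (Continuous.prodMk_right y)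
    exact continuous_iff_continuousAt.2 fun x ↦
      (ENNReal.continuousAt_toReal (hfin y x)).comp h1.continuousAt
  -- the gradient field and `Φ_r`
  set V : Π x : M, TangentSpace (𝓡 m) x := grad g u with hV_def
  have hV : ContMDiff (𝓡 m) (𝓡 m).tangent ∞
      (fun z ↦ (TotalSpace.mk' (EuclideanSpace ℝ (Fin m)) z (V z) : TangentBundle (𝓡 m) M)) :=
    contMDiff_grad g hu
  have hgradSq : ∀ x, g.gradSq u x = g.val x (V x) (V x) := fun x ↦ by
    rw [val_grad]; rfl
  -- a bound for the distances from `x₀` on `closure D`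
  obtain ⟨R₀, hR₀, hK⟩ : ∃ R₀ : ℝ, 0 ≤ R₀ ∧
      ∀ x ∈ closure D, g.edist hg x₀ x ≤ ENNReal.ofReal R₀ := by
    obtain ⟨B, hB⟩ := hDc.bddAbove_image (hdc x₀).continuousOn
    refine ⟨max B 0, le_max_right _ _, fun x hx ↦ ?_⟩
    rw [← ENNReal.ofReal_toReal (hfin x₀ x)]
    exact ENNReal.ofReal_le_ofReal ((hB (mem_image_of_mem _ hx)).trans (le_max_left _ _))
  -- the set `U`
  set U : Set M := {x | x ∈ D ∧ g.gradSq u x < 1} with hU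
  have hUD : U ⊆ closure D := fun x hx ↦ subset_closure hx.1
  have hUm : MeasurableSet U := (hD.inter (isOpen_lt hgc continuous_const)).measurableSet
  have hUfin : μ U ≠ ⊤ := (lt_of_le_of_lt (measure_mono hUD) (hDc.measure_lt_top)).ne
  have hκm : AEStronglyMeasurable κ (μ.restrict U) := hκc.aestronglyMeasurable
  have hκi : IntegrableOn (fun x ↦ κ x ^ m) U μ :=
    ((hκc.pow m).continuousOn.integrableOn_compact hDc).mono_set hUD
  -- the main estimate for every `r > 0`
  have hbound : ∀ r : ℝ, 0 < r → μ {p | ∀ x ∈ closure D, g.edist hg x p < ENNReal.ofReal r} ≤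
      ENNReal.ofReal (∫ x in U, (1 + r * κ x) ^ m ∂μ) := by
    intro r hr
    -- the map `Φ_r` and the contact set `A`
    set Φ : M → M := fun z ↦ expMap g.leviCivita z (r • V z) with hΦ_def
    have hΦs : ContMDiff (𝓡 m) (𝓡 m) ∞ Φ := contMDiff_expMap_field_smul g hc hV r
    set A : Set M := {x | x ∈ D ∧ g.gradSq u x < 1 ∧ ∀ y ∈ closure D,
      r * u x + 1 / 2 * r ^ 2 * g.gradSq u x ≤
        r * u y + 1 / 2 * (g.edist hg y (Φ x)).toReal ^ 2} with hA_def
    have hAU : A ⊆ U := fun x hx ↦ ⟨hx.1, hx.2.1⟩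
    -- measurability of `A`
    have hAm : MeasurableSet A := by
      have hA' : A = (D ∩ {x | g.gradSq u x < 1}) ∩ ⋂ y ∈ closure D,
          {x | r * u x + 1 / 2 * r ^ 2 * g.gradSq u x ≤
            r * u y + 1 / 2 * (g.edist hg y (Φ x)).toReal ^ 2} := by
        ext x
        simp only [hA_def, mem_setOf_eq, mem_inter_iff, mem_iInter]
        tauto
      rw [hA']
      refine (hD.inter (isOpen_lt hgc continuous_const)).measurableSet.inter ?_
      refine (isClosed_biInter fun y _ ↦ ?_).measurableSet
      exact isClosed_le ((continuous_const.mul huc).add (continuous_const.mul hgc))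
        (continuous_const.add (continuous_const.mul (((hdc y).comp hΦs.continuous).pow 2)))
    -- Step 1 (Lemma 2.2): the set of `p` is covered by `Φ '' A`
    have hcover : {p | ∀ x ∈ closure D, g.edist hg x p < ENNReal.ofReal r} ⊆ Φ '' A := by
      intro p hp
      obtain ⟨x₁, hx₁D, hmin⟩ := hcontact r hr p hp
      obtain ⟨v, -, hvp, hvd⟩ := exists_isMinimizingUpTo_expMap_eq g le_rfl hg hc x₁ p
      set V₀ : TangentSpace (𝓡 m) x₁ := r⁻¹ • (show TangentSpace (𝓡 m) x₁ from v) with hV₀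
      have hrV : r • V₀ = (show TangentSpace (𝓡 m) x₁ from v) := by
        rw [hV₀, smul_smul, mul_inv_cancel₀ hr.ne', one_smul]
      have hp' : expMap g.leviCivita x₁ (r • V₀) = p := by rw [hrV]; exact hvp
      have hgVV : 0 ≤ g.val x₁ V₀ V₀ := by
        by_cases hv0 : V₀ = 0
        · rw [hv0]; simp
        · exact (hg x₁ V₀ hv0).le
      have hvv : g.val x₁ (r • V₀) (r • V₀) = r * r * g.val x₁ V₀ V₀ := by
        simp only [map_smul, smul_apply, smul_eq_mul]
        ring
      have hdist : (g.edist hg x₁ p).toReal = r * Real.sqrt (g.val x₁ V₀ V₀) := by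
        rw [hvd, ENNReal.toReal_ofReal (Real.sqrt_nonneg _), ← hrV, hvv,
          Real.sqrt_mul (mul_self_nonneg r), Real.sqrt_mul_self hr.le]
      have hloc : ∀ᶠ y in 𝓝 x₁, r * u x₁ + 1 / 2 * (r * Real.sqrt (g.val x₁ V₀ V₀)) ^ 2 ≤
          r * u y + 1 / 2 * (g.edist hg y (expMap g.leviCivita x₁ (r • V₀))).toReal ^ 2 := by
        filter_upwards [hD.mem_nhds hx₁D] with y hy
        rw [hp', ← hdist]
        exact hmin y (subset_closure hy)
      obtain ⟨w, hw⟩ := exists_orthonormal_basis_fin g hg x₁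
      have hgrad : grad g u x₁ = V₀ := grad_eq_of_contact g hg hc hu x₁ V₀ hr hcard w hw hloc
      have hΦx : Φ x₁ = p := by
        show expMap g.leviCivita x₁ (r • grad g u x₁) = p
        rw [hgrad]; exact hp'
      have hdr : (g.edist hg x₁ p).toReal < r := by
        have h1 := hp x₁ (subset_closure hx₁D)
        exact (ENNReal.toReal_lt_toReal (hfin x₁ p) ENNReal.ofReal_ne_top).2 h1 |>.trans_eq
          (ENNReal.toReal_ofReal hr.le)
      have hgs : g.gradSq u x₁ = g.val x₁ V₀ V₀ := by rw [hgradSq, hV_def, hgrad]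
      have hsq : r ^ 2 * g.gradSq u x₁ = (g.edist hg x₁ p).toReal ^ 2 := by
        rw [hgs, hdist, mul_pow, Real.sq_sqrt hgVV]
      refine ⟨x₁, ⟨hx₁D, ?_, fun y hy ↦ ?_⟩, hΦx⟩
      · -- `|∇u(x₁)| < 1`
        have h1 : (g.edist hg x₁ p).toReal ^ 2 < r ^ 2 := by
          have h0 : 0 ≤ (g.edist hg x₁ p).toReal := ENNReal.toReal_nonneg
          nlinarith
        rw [← hsq] at h1
        have : g.gradSq u x₁ < 1 := by
          by_contra hge; push Not at hge
          have := mul_le_mul_of_nonneg_left hge (sq_nonneg r)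
          nlinarith
        exact this
      · rw [hΦx, mul_assoc, ← mul_assoc (1 / 2 : ℝ), show (1 : ℝ) / 2 * r ^ 2 * g.gradSq u x₁ =
          1 / 2 * (r ^ 2 * g.gradSq u x₁) by ring, hsq]
        exact hmin y hy
    -- Step 2 (Lemmas 2.3–2.4, Prop. 2.5, Cor. 2.6): the frame bound on `A`
    have hJ : ∀ x ∈ A, ∃ (e : Fin m → TangentSpace (𝓡 m) x) (ε : Fin m → TangentSpace (𝓡 m) (Φ x))
        (Amat : Matrix (Fin m) (Fin m) ℝ),
        (∀ i j, h.inner x (e i) (e j) = if i = j then 1 else 0) ∧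
        (∀ i j, h.inner (Φ x) (ε i) (ε j) = if i = j then 1 else 0) ∧
        (∀ k, mfderiv (𝓡 m) (𝓡 m) Φ x (e k) = ∑ i, Amat i k • ε i) ∧
        ENNReal.ofReal |Amat.det| ≤ ENNReal.ofReal ((1 + r * κ x) ^ m) := by
      intro x hx
      obtain ⟨hxD, hgs, hcon⟩ := hx
      obtain ⟨w, hw⟩ := exists_orthonormal_basis_fin g hg x
      have hgVV : 0 ≤ g.val x (V x) (V x) := by
        by_cases hv0 : V x = 0
        · rw [hv0]; simp
        · exact (hg x (V x) hv0).le
      have hloc : ∀ᶠ y in 𝓝 x, r * u x + 1 / 2 * (r * Real.sqrt (g.val x (V x) (V x))) ^ 2 ≤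
          r * u y + 1 / 2 * (g.edist hg y (expMap g.leviCivita x (r • V x))).toReal ^ 2 := by
        filter_upwards [hD.mem_nhds hxD] with y hy
        have h1 := hcon y (subset_closure hy)
        rw [mul_pow, Real.sq_sqrt hgVV, ← hgradSq]
        calc r * u x + 1 / 2 * (r ^ 2 * g.gradSq u x)
            = r * u x + 1 / 2 * r ^ 2 * g.gradSq u x := by ring
          _ ≤ r * u y + 1 / 2 * (g.edist hg y (Φ x)).toReal ^ 2 := h1
      have hSV0 := fun X hX hXr ↦ (secondVariation_of_contact g hg hc hu x (V x) hr hloc X hX hXr).2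
      have hΔ : g.dalembertian u x ≤ Fintype.card (Fin m) * κ x := by
        rw [Fintype.card_fin]; exact hpde x hxD hgs
      obtain ⟨ε, Amat, hε, hexp, hdet⟩ := exists_frame_abs_det_mfderiv_le g hg hc hRic' hu x hr
        (hκ0 x) hcard hΔ w hw hSV0
      refine ⟨w, ε, Amat, fun i j ↦ ?_, fun i j ↦ ?_, hexp, ?_⟩
      · rw [hh_def, toContMDiffRiemannianMetric_inner]; exact hw i j
      · rw [hh_def, toContMDiffRiemannianMetric_inner]; exact hε i j
      · rw [Fintype.card_fin] at hdet
        exact ENNReal.ofReal_le_ofReal hdet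
    -- Step 3: the area inequality and the integral over `U`
    have hJm : Measurable fun x : M ↦ ENNReal.ofReal ((1 + r * κ x) ^ m) :=
      ENNReal.measurable_ofReal.comp
        ((continuous_const.add (continuous_const.mul hκc)).pow m).measurable
    have harea := riemannianMeasure_image_le_lintegral_of_frame h hΦs.continuous hAm
      (fun x _ ↦ (hΦs x).mdifferentiableAt (by simp)) hJm hJ
    have hint : ∫⁻ x in U, ENNReal.ofReal ((1 + r * κ x) ^ m) ∂μ =
        ENNReal.ofReal (∫ x in U, (1 + r * κ x) ^ m ∂μ) := by
      rw [ofReal_integral_eq_lintegral_ofReal]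
      · exact (((continuous_const.add (continuous_const.mul hκc)).pow m
          ).continuousOn.integrableOn_compact hDc).mono_set hUD
      · exact Eventually.of_forall fun x ↦ pow_nonneg (by nlinarith [hκ0 x, hr.le]) _
    calc μ {p | ∀ x ∈ closure D, g.edist hg x p < ENNReal.ofReal r}
        ≤ μ (Φ '' A) := measure_mono hcover
      _ ≤ ∫⁻ x in A, ENNReal.ofReal ((1 + r * κ x) ^ m) ∂μ := harea
      _ ≤ ∫⁻ x in U, ENNReal.ofReal ((1 + r * κ x) ^ m) ∂μ := lintegral_mono_set hAU
      _ = ENNReal.ofReal (∫ x in U, (1 + r * κ x) ^ m ∂μ) := hint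
  exact volumeRatio_mul_le_setIntegral_pow_of_measure_le (d := fun x y ↦ g.edist hg x y)
    (K := closure D) hcB (fun x y ↦ g.edist_comm hg x y) (fun x y z ↦ g.edist_triangle hg x y z)
    havr hR₀ hK hUfin hκ0 hκm hκi
    (by filter_upwards [eventually_gt_atTop 0] with r hr using hbound r hr)

end Main

end Literature.Geometry.Riemannian
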